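import Summits.NavierStokesRegularity.NavierStokesRegularity.Theorems.TerminalTraceTypeITraceScarL3ExtinctApexUnit
import Literature.Analysis.FluidPDE.NSViscosityRescaling
import Literature.Analysis.FluidPDE.NSLerayHopfABCScaling
import HarnessLib

/-!
# Line `extinct-apex` of `TerminalTrace.TypeITraceScarL3` (stmt-NavierStokesRegularity-18385) —
# STUB 2 `stub_extinctApex_of_L3trace`, BY NAME AND SIGNATURE

Route `TerminalTrace` (NavierStokesRegularity), item `TypeITraceScarL3` (the Type-I-in-time cell of the
terminal-trace scar: a Type-I first-time singularity scars `u(T)` out of `L³` near the singular point),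
registered skeleton `extinct-apex` (nsreg-p2 g26, ROUND-24; `Cruxes/TypeITraceScarL3/Lines`, sha16
07e82d2c7e70161a; three stubs: Stub 1 `stub_localTypeI_of_typeIBlowup` LANDED by nsreg-p4 g14 p576636, Stub 2
here, Stub 3 `stub_no_extinctApex` = the extinction Liouville theorem, OPEN).  Seat ns-typeII-p3 g9 (cell
ns-regularity-ideate), `--supports stmt-NavierStokesRegularity-18385`.

* `not_isBackwardBoundedAt_viscosityRescale` — the failure of backward boundedness at `(T, x₀)` passes to
  the unit-viscosity rescaling `v(s, x) = ν⁻¹ u(s/ν, x)` (blow-up time `νT`, same point `x₀`); the Type-I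
  rate in time passes inside the proof (constant `C/√ν`; the tree's `isTypeIBlowup_timeRescale` states it
  in a module with a route-file import cone, so it is re-derived inline);
* `not_isBackwardBoundedAt_of_forall_eLpNorm_top` — the stub's singular-vertex premise
  (`‖u‖_{L^∞(Q_r(T, x₀))} = ∞` for every `r > 0`) forbids backward boundedness at `(T, x₀)`;
* **`stub_extinctApex_of_L3trace`** — the registered signature verbatim: in the frame of the item
  (`ν, T > 0`, classical on `[0, T)`, Leray–Hopf on `[0, T]`, Type-I in time), at a backward-singular apex
  `(T, x₀)` with `u(T) ∈ L³(B(x₀, ρ))` there is an EXTINCT TYPE-I APEX `(U, P, G, M, C)`: suitable in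
  every `Q(a)` with weak gradient `G`, `𝐈(Q(a)) ≤ M` at every scale, rate `C/√(−s)`, weakly vanishing at
  the top time, backward-singular at the origin.  Proof: normalise `ν ↦ 1`
  (`IsClassicalNSSolutionOn.viscosityRescale_set`, `IsLerayHopfOn.viscosityRescale`; the final slice,
  the rate and the apex transform trivially) and apply `extinctApex_of_L3trace_unit`.  The local
  Albritton–Barker bound among the hypotheses (the output of Stub 1) is not needed: the GLOBAL Type-I
  rate in time already gives the Morrey bound (`morrey_of_typeI`).

WHAT THIS IS NOT: not NS regularity, not item 18385, not Stub 3 — after this file the line `extinct-apex`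
is closed modulo exactly its one OPEN stub, the extinction Liouville theorem for local-energy Type-I
ancient apices with null top trace (Seregin 2014, p. 127).  [folklore; AlbrittonBarker2019 §3;
Seregin2014 §6.6; SereginSverak2002 §4; Tao 2013 footnote 3 for the viscosity normalisation]
-/

noncomputable section

set_option linter.dupNamespace false

namespace Summit.NavierStokesRegularity.NavierStokesRegularity.Theorems.TypeITraceScarL3

open MeasureTheory Set Function Filter Topology TopologicalSpace Metric
open Literature.Analysis.FluidPDE
open scoped NNReal ENNReal InnerProductSpace RealInnerProductSpace

local notation "ℝ³" => EuclideanSpace ℝ (Fin 3)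

/-! ### The viscosity normalisation `ν ↦ 1` of the remaining hypotheses -/

/-- **Backward boundedness at `(νT, x₀)` of the rescaling gives backward boundedness of `u` at `(T, x₀)`**:
`u(t, x) = ν v(νt, x)`, and the cylinder of radius `min r (r/√ν)` at `(T, x₀)` maps into that of radius
`r` at `(νT, x₀)`. [folklore] -/
theorem not_isBackwardBoundedAt_viscosityRescale {ν T : ℝ} (hν : 0 < ν)
    {u : ℝ → EuclideanSpace ℝ (Fin 3) → EuclideanSpace ℝ (Fin 3)} {x₀ : EuclideanSpace ℝ (Fin 3)}
    (h : ¬ IsBackwardBoundedAt u T x₀) :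
    ¬ IsBackwardBoundedAt (timeRescale ν⁻¹ ν⁻¹ u) (ν * T) x₀ := by
  rintro ⟨r, hr, K, hK⟩
  apply h
  have hν0 : ν ≠ 0 := hν.ne'
  have hsν : 0 < Real.sqrt ν := Real.sqrt_pos.2 hν
  set r' : ℝ := min r (r / Real.sqrt ν) with hr'
  have hr'pos : 0 < r' := lt_min hr (by positivity)
  have hr'r : r' ≤ r := min_le_left _ _
  have hr'ν : ν * r' ^ 2 ≤ r ^ 2 := by
    have h1 : r' ≤ r / Real.sqrt ν := min_le_right _ _
    have h2 : r' * Real.sqrt ν ≤ r := by rwa [le_div_iff₀ hsν] at h1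
    have h3 : (r' * Real.sqrt ν) ^ 2 ≤ r ^ 2 := pow_le_pow_left₀ (by positivity) h2 2
    calc ν * r' ^ 2 = (r' * Real.sqrt ν) ^ 2 := by rw [mul_pow, Real.sq_sqrt hν.le]; ring
      _ ≤ r ^ 2 := h3
  refine ⟨r', hr'pos, ν * K, fun t ht x hx => ?_⟩
  have hs : ν * t ∈ Ioo (ν * T - r ^ 2) (ν * T) := by
    constructor
    · have : ν * (T - r' ^ 2) < ν * t := mul_lt_mul_of_pos_left ht.1 hν
      nlinarith
    · exact mul_lt_mul_of_pos_left ht.2 hν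
  have hxr : x ∈ ball x₀ r := ball_subset_ball hr'r hx
  have hb := hK (ν * t) hs x hxr
  rw [timeRescale_apply, norm_smul, Real.norm_eq_abs, abs_of_pos (inv_pos.2 hν), ← mul_assoc,
    inv_mul_cancel₀ hν0, one_mul] at hb
  -- `hb : ν⁻¹ ‖u t x‖ ≤ K`
  have := mul_le_mul_of_nonneg_left hb hν.le
  rwa [← mul_assoc, mul_inv_cancel₀ hν0, one_mul] at this

/-! ### The singular-vertex premise forbids backward boundedness -/

/-- **`‖u‖_{L^∞(Q_r(T, x₀))} = ∞` for every `r > 0` forbids backward boundedness at `(T, x₀)`**: a bound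
`‖u‖ ≤ K` on `(T − r², T) × B(x₀, r)` makes the `L^∞` norm on `Q_r(T, x₀)` finite. [folklore] -/
theorem not_isBackwardBoundedAt_of_forall_eLpNorm_top {T : ℝ}
    {u : ℝ → EuclideanSpace ℝ (Fin 3) → EuclideanSpace ℝ (Fin 3)} {x₀ : EuclideanSpace ℝ (Fin 3)}
    (hsing : ∀ r : ℝ, 0 < r →
      eLpNorm (uncurry u) ⊤ (volume.restrict (parabolicCylinder r (T, x₀))) = ⊤) :
    ¬ IsBackwardBoundedAt u T x₀ := by
  rintro ⟨r, hr, K, hK⟩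
  have hfin : eLpNorm (uncurry u) ⊤ (volume.restrict (parabolicCylinder r ((T : ℝ), x₀))) < ⊤ := by
    rw [eLpNorm_exponent_top]
    refine eLpNormEssSup_lt_top_of_ae_bound (C := K) ?_
    refine (ae_restrict_mem (isOpen_parabolicCylinder r _).measurableSet).mono ?_
    rintro ⟨t, x⟩ hz
    rw [mem_parabolicCylinder] at hz
    exact hK t ⟨hz.1.1, hz.1.2⟩ x (mem_ball.2 hz.2)
  exact hfin.ne (hsing r hr)

/-! ### The stub -/

/-- **STUB 2 of line `extinct-apex` (item stmt-NavierStokesRegularity-18385 `TerminalTrace.TypeITraceScarL3`),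
registered signature.**  In the frame of the item (`ν, T > 0`, `(u, p)` classical on `[0, T)`, Leray–Hopf on
`[0, T]` from its datum, Type-I in time), let `(T, x₀)` be a backward-singular apex (with the local
Albritton–Barker bound of Stub 1, unused here) and suppose `u(T) ∈ L³(B(x₀, ρ))` for some `ρ > 0`.  Then
there is an EXTINCT TYPE-I APEX: `(U, P)` suitable in every parabolic ball `Q(a)` at the space–time origin
with a weak spatial gradient `G`, Albritton–Barker bound `𝐈(Q(a)) ≤ M` at every scale, the rate
`‖U(s, y)‖ ≤ C/√(−s)` (a.e. `y`, every `s < 0`), weakly vanishing at the top time, and backward-singular at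
the origin.  Proof: `¬ IsBackwardBoundedAt` from the vertex premise, viscosity normalisation, and
`extinctApex_of_L3trace_unit` (Morrey bound of the Type-I rate, vertex zoom in Albritton–Barker's class,
Seregin's zoom-in extraction with persistence of the singularity, rate a.e., pointwise-rate representative,
and the top-time vanishing from the `L³` ball through the uniform pairing modulus).
[folklore; AlbrittonBarker2019 §3 Rem. 3.2, Lemma 2.2, Prop. 2.3; Seregin2014 §6.6 Prop. 6.20, (6.6.2)–(6.6.3); SereginSverak2002 §4] -/
theorem stub_extinctApex_of_L3trace :
    ∀ (ν T : ℝ), 0 < ν → 0 < T → ∀ (u : ℝ → ℝ³ → ℝ³) (p : ℝ → ℝ³ → ℝ),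
      IsClassicalNSSolutionOn (Ico 0 T) ν 0 u p → IsLerayHopfOn T ν 0 (u 0) u →
      IsTypeIBlowup u T → ∀ x₀ : ℝ³,
      (∃ r₀ : ℝ, 0 < r₀ ∧ ∃ G : ℝ → ℝ³ → ℝ³ →L[ℝ] ℝ³,
          HasWeakSpatialGradientOn (parabolicCylinderOpens r₀ (T, x₀)) u G ∧
          typeIBound (parabolicCylinder r₀ (T, x₀)) u p G < ∞) →
      (∀ r : ℝ, 0 < r →
        eLpNorm (uncurry u) ⊤ (volume.restrict (parabolicCylinder r (T, x₀))) = ⊤) →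
      (∃ ρ : ℝ, 0 < ρ ∧ MemLp (u T) 3 (volume.restrict (ball x₀ ρ))) →
        ∃ (U : ℝ → ℝ³ → ℝ³) (P : ℝ → ℝ³ → ℝ) (G : ℝ → ℝ³ → ℝ³ →L[ℝ] ℝ³) (M : ℝ≥0) (C : ℝ),
          (∀ a : ℝ, 0 < a → IsSuitableWeakSolutionInBall a (0 : ℝ × ℝ³) U P) ∧
          (∀ a : ℝ, 0 < a → HasWeakSpatialGradientOn (parabolicCylinderOpens a (0 : ℝ × ℝ³)) U G) ∧
          (∀ a : ℝ, 0 < a → typeIBound (parabolicCylinder a (0 : ℝ × ℝ³)) U P G ≤ M) ∧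
          (∀ s : ℝ, s < 0 → ∀ᵐ y : ℝ³, ‖U s y‖ ≤ C / Real.sqrt (-s)) ∧
          (∀ φ : ℝ³ → ℝ³, ContDiff ℝ (⊤ : ℕ∞) φ → HasCompactSupport φ → ∀ ε : ℝ, 0 < ε →
            ∃ s₀ : ℝ, s₀ < 0 ∧ ∀ᵐ s ∂(volume.restrict (Ioo s₀ 0)), |∫ y, ⟪U s y, φ y⟫| ≤ ε) ∧
          IsBackwardSingularPoint U (0 : ℝ × ℝ³) := by
  intro ν T hν hT u p hcl hLH hI x₀ _ hsing htr
  obtain ⟨ρ, hρ, hmem⟩ := htr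
  have hν0 : ν ≠ 0 := hν.ne'
  have hνi : 0 < ν⁻¹ := inv_pos.2 hν
  have hνT : 0 < ν * T := mul_pos hν hT
  -- the apex is not backward bounded
  have hnotbd : ¬ IsBackwardBoundedAt u T x₀ := not_isBackwardBoundedAt_of_forall_eLpNorm_top hsing
  -- ## viscosity normalisation `v(s, x) = ν⁻¹ u(s/ν, x)`, blow-up time `νT`
  set v : ℝ → ℝ³ → ℝ³ := timeRescale ν⁻¹ ν⁻¹ u with hv
  set pv : ℝ → ℝ³ → ℝ := timeRescale ν⁻¹ (ν⁻¹ ^ 2) p with hpv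
  have hmaps : MapsTo (fun s => ν⁻¹ * s) (Ico 0 (ν * T)) (Ico 0 T) := by
    intro s hs
    refine ⟨mul_nonneg hνi.le hs.1, ?_⟩
    calc ν⁻¹ * s < ν⁻¹ * (ν * T) := mul_lt_mul_of_pos_left hs.2 hνi
      _ = T := by rw [← mul_assoc, inv_mul_cancel₀ hν0, one_mul]
  -- (1) classical at viscosity 1 on `[0, νT)`
  have hclv : IsClassicalNSSolutionOn (Ico 0 (ν * T)) 1 0 v pv := by
    have h := hcl.viscosityRescale_set hν0 hmaps (uniqueDiffOn_Ico 0 (ν * T))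
    rwa [timeRescale_zero_force] at h
  -- (2) Leray–Hopf on `[0, νT]`
  have hv0 : ν⁻¹ • u 0 = v 0 := by
    funext x
    simp [hv]
  have hLHv : IsLerayHopfOn (ν * T) 1 0 (v 0) v := by
    have h := hLH.viscosityRescale hνi
    have e1 : T / ν⁻¹ = ν * T := by rw [div_inv_eq_mul, mul_comm]
    rwa [e1, inv_mul_cancel₀ hν0, timeRescale_zero_force, hv0] at h
  -- (3) the Type-I rate and (4) the apex
  have hIv : IsTypeIBlowup v (ν * T) := by
    -- the Type-I rate in time passes to the rescaling (inlined; the tree's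
    -- `isTypeIBlowup_timeRescale` lives in a module with a route-file import cone)
    obtain ⟨C, hC⟩ := hI
    have e0 : ν⁻¹ * (ν * T) = T := by rw [← mul_assoc, inv_mul_cancel₀ hν0, one_mul]
    have htend : Tendsto (fun s : ℝ => ν⁻¹ * s) (𝓝[<] (ν * T)) (𝓝[<] T) := by
      refine tendsto_nhdsWithin_of_tendsto_nhds_of_eventually_within _ ?_ ?_
      · have h := ((continuous_const_mul ν⁻¹).tendsto (ν * T)).mono_left
          (nhdsWithin_le_nhds (s := Iio (ν * T)))
        rwa [e0] at h
      · refine eventually_nhdsWithin_of_forall fun s hs => ?_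
        have h := mul_lt_mul_of_pos_left (mem_Iio.1 hs) hνi
        rwa [e0] at h
    refine ⟨C / Real.sqrt ν, ?_⟩
    filter_upwards [htend.eventually hC, self_mem_nhdsWithin] with s hs hsT x
    have hsT' : s < ν * T := hsT
    have hpos : 0 < ν * T - s := sub_pos.2 hsT'
    have e : T - ν⁻¹ * s = ν⁻¹ * (ν * T - s) := by field_simp
    have hsq : Real.sqrt (T - ν⁻¹ * s) = (Real.sqrt ν)⁻¹ * Real.sqrt (ν * T - s) := by
      rw [e, Real.sqrt_mul hνi.le, Real.sqrt_inv]
    have hb := hs x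
    rw [hsq] at hb
    have hsν : 0 < Real.sqrt ν := Real.sqrt_pos.2 hν
    have hsνsq : Real.sqrt ν * Real.sqrt ν = ν := Real.mul_self_sqrt hν.le
    have hsqpos : 0 < Real.sqrt (ν * T - s) := Real.sqrt_pos.2 hpos
    rw [le_div_iff₀ (by positivity)] at hb
    have hνinv : ν⁻¹ = (Real.sqrt ν)⁻¹ * (Real.sqrt ν)⁻¹ := by rw [← mul_inv, hsνsq]
    have key : ν⁻¹ * ‖u (ν⁻¹ * s) x‖ ≤ C / Real.sqrt ν / Real.sqrt (ν * T - s) := by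
      rw [le_div_iff₀ hsqpos]
      calc ν⁻¹ * ‖u (ν⁻¹ * s) x‖ * Real.sqrt (ν * T - s)
          = (Real.sqrt ν)⁻¹ * (‖u (ν⁻¹ * s) x‖ * ((Real.sqrt ν)⁻¹ * Real.sqrt (ν * T - s))) := by
              rw [hνinv]; ring
        _ ≤ (Real.sqrt ν)⁻¹ * C := mul_le_mul_of_nonneg_left hb (inv_nonneg.2 hsν.le)
        _ = C / Real.sqrt ν := by rw [div_eq_inv_mul]
    have e2 : ‖v s x‖ = ν⁻¹ * ‖u (ν⁻¹ * s) x‖ := by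
      rw [hv, timeRescale_apply, norm_smul, Real.norm_eq_abs, abs_of_pos hνi]
    exact e2 ▸ key
  have hnotbdv : ¬ IsBackwardBoundedAt v (ν * T) x₀ := not_isBackwardBoundedAt_viscosityRescale hν hnotbd
  -- (5) the `L³` ball of the final value: `v(νT) = ν⁻¹ u(T)`
  have hmemv : MemLp (v (ν * T)) 3 (volume.restrict (ball x₀ ρ)) := by
    have e : v (ν * T) = fun x => ν⁻¹ • u T x := by
      funext x
      rw [hv, timeRescale_apply, ← mul_assoc, inv_mul_cancel₀ hν0, one_mul]
    rw [e]
    exact hmem.const_smul ν⁻¹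
  -- ## the unit-viscosity theorem
  exact extinctApex_of_L3trace_unit hνT hclv hLHv hIv x₀ hnotbdv hρ hmemv

end Summit.NavierStokesRegularity.NavierStokesRegularity.Theorems.TypeITraceScarL3

end
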